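import Summits.Ventures.HSemireg.SecantParityWeilTypeEndomorphism
import Literature.Geometry.Kaehler.ComplexTorusWeilTypeHermitianForm
import Literature.Geometry.Kaehler.ComplexTorusDualPolarizationType
import Literature.Geometry.Kaehler.ComplexTorusSelfIntersectionIndex
import Literature.Geometry.Kaehler.ComplexTorusRationalFormsBasis
import Literature.Geometry.Kaehler.ComplexTorusProduct
import HarnessLib

/-!
# Venture HSemireg — the DISCRIMINANT of Markman's Weil-type triple `(X × X̂, K, N·(±Ξ_d))` is `(-1)^{dim X}`:
# [Mar25 Lemma 3.1.3] at the object level — every `K`-secant triple lies on the SPLIT component `(n, K, (-1)ⁿ·Nm Kˣ)`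
# — TRACK S4-PUSH (ii), seat `s4-prove-1` (g13); file XIIe, record `s4push/prove-1/ATTEMPT-16.md`

HONEST FRAMING. Lean index of the computation cell `pub-hsemireg`; OBJECT LEVEL as in files XII ∕ XIIb∕c ∕ XIId of this lane:
the complex torus `X = E/Φ(ℤ^ι)` of the tree's Literature layer, its dual `X̂` (`dualPeriod Φ`), the product `X × X̂`
(`prodPeriod Φ (dualPeriod Φ)`), a non-degenerate `η ∈ NS(X)` with integer Gram matrix `G` on the lattice basis, Lang's transport
`η^* = dualForm`, Markman's form `Ξ_d = d·η ⊞ η^*` and the rational matrix `A = (0 (ᵗG)⁻¹; -d·ᵗG 0) ∈ End_ℚ(X × X̂)` (`A² = -d`,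
`ρₐ(A) = F_d`; files XII ∕ XIIb∕c), and the tree's predicate `ComplexTorus.IsPolarizedWeilType` with ITS discriminant
`IsPolarizedWeilType.discriminant : ℚˣ ⧸ Nm(Kˣ)` (Literature `ComplexTorusWeilTypeHermitianForm`, Lange §7.3.3 Exercise (5)(c) ∕
[vG94 Lemma 5.2 (3)]). WHAT IS PROVED: whenever `(X × X̂, N·Ξ_d, A)` (or `(X × X̂, N·(-Ξ_d), A)`) is a polarised complex torus of Weil
type in the tree's sense — by file XIId this is EXACTLY «`η` (resp. `-η`) is a Riemann form of `X`» — its discriminant is the class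
of `(-1)^{dim X}`: the printed [Mar25 Lemma 3.1.3] «Then the discriminant of the hermitian form `H` is `(-1)ⁿ`», with Markman's
`K`-basis replaced by the lattice basis of the factor `X` (`H₁(X, ℚ) ⊕ 0 ⊂ H₁(X × X̂, ℚ)`), on which the tree's Hermitian form
`H(x, y) = E(x, √-d·y) + √-d·E(x, y)` has Gram matrix `√-d · (N d) · G` — purely imaginary: the factor is `Re H`-ISOTROPIC —
so `det H = (-d)^g (N d)^{2g} det G`, `det G = Pf(G)²` (tree `IsPolarizationType.det_latticeGram`) and `d = Nm(√-d)`.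
READING (cell records STRUCTURE.md v1.0 D6 «SPLIT-ONLY MECHANISM», (S4) «boxes on the split component (n, K, (-1)ⁿ·Nm)»):
Markman's secant construction only ever produces the discriminant class `(-1)ⁿ` (`n = dim X`) — the SPLIT class in the
convention of [Mar25b §1.1] ∕ [Del82 Cor. 4.2] — for EVERY `X`, EVERY secant direction `b = η` (polarising or not) and EVERY
`d`; so the non-split components of the Weil locus are not reached by ANY `K`-secant triple `(X × X̂, f, Ξ_P)`. To this
seat's knowledge (tree grep, 2026-08-24) it is the first explicit discriminant VALUE in the tree's torus layer (the Literature
files define the invariant and prove its basis ∕ isogeny ∕ pull-back invariance; `ComplexTorusWeilTypeEllipticSquare` stops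
before «`det H = 1`»). Nothing here says that HC, HC_CM or HC_AV
holds; nothing is a new case of anything; (S3)'s signed words («PROVED given `∫bⁿ > 0`», STRUCTURE.md v1.0 §2; STATUS WORD s4-ref
P-2) do not move. NO definition, NO named fact, NO sorry; theorems only. Imports file XIIb∕c (`SecantParityWeilTypeEndomorphism`:
the matrix `A`, `isUnit_det_transposeGram`, `map_ratCast_transposeGram`) and Literature only; the polarised-Weil-type structure enters
as the HYPOTHESIS `h`, which file XIId discharges from `IsRiemannForm Φ (±η)` (no import of XII ∕ XIId needed).

## §1 Block core (pure linear algebra over `K = ℚ(√-d)`)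
For `α = (0 B; C 0) ∈ M_{ι ⊔ ι}(ℚ)` with `α² = -d` and a block-diagonal Gram matrix `G = (G₁ 0; 0 G₂)`: on the standard vectors
`e_i` of the FIRST block, `H(e_i, e_j) = √-d · (G₁)ᵢⱼ` (`hermFun_single_inl`; real part `0`); if `det C ≠ 0` they form a `K`-basis
of `H₁ = ℚ^{ι ⊔ ι}` (`linearIndependent_single_inl`, `finrank_weilVec_sum`); the Gram matrix is `√-d · G₁` (`hermGram_single_inl`)
with `det = (-d)^k · det G₁` for `#ι = 2k` (`det_omega_smul_map_re`); and `[(-d)^k · r²] = [(-1)^k]` in `ℚˣ ⧸ Nm(Kˣ)`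
(`mk_mk0_neg_pow_mul_sq`, from `d = Nm(√-d)`, `r² = Nm(r)`).
## §2 Markman's triple
`map_ratCast_blockGram(_neg)`: the rational Gram matrix of `N·(±Ξ_d)` on the lattice basis of `X × X̂` is
`(±N d·G 0; 0 ±N·(ᵗG)⁻¹)`; **`discriminant_smul_Xi`**, **`discriminant_smul_neg_Xi`**: the discriminant is `[(-1)^{dim_ℂ X}]`;
`discriminant_eq_of_isIsogeny_of_blockGram`: so is the discriminant of every polarised Weil-type torus `K`-isogenous to such a triple
(tree isogeny invariance).

## References
* [Markman2025SecantWeil] = [Mar25] E. Markman, *Cycles on abelian 2n-folds of Weil type from secant sheaves on abelian n-folds*,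
  arXiv:2502.03415 (2025), §3.1 Lemma 3.1.3 «Assume that the similarity `f` … is defined in terms of the oriented plane `P` … Then
  the discriminant of the hermitian form `H` is `(-1)ⁿ`.» with its proof («`H((0,y_i),(0,y_j)) = d√-d Θ(y_i,y_j)`,
  «`det(Θ(y_i,y_j))` is the square of a rational number, since `Θ` is anti-symmetric»); held text `paper:arxiv-2502.03415` p0019.
* [Markman2025SurveySecant] = [Mar25b] E. Markman, arXiv:2509.23403, §1.1 («`(A, η, h)` is said to be of split Weil type, if `H`
  has an isotropic subspace of half the dimension»), §11.5.
* [Lange2023AbelianVarietiesComplex] H. Lange, *Abelian Varieties over the Complex Numbers* (2023), §7.3.3 Exercise (5)(a)(c)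
  (the Hermitian form and its discriminant), §1.5.3 ∕ §1.7.1 (`det E = Pf(E)²`), §2.4.4 Cor. 2.4.24, §2.5.1 Prop. 2.5.1.
* [vanGeemen1994HodgeAV] = [vG94] B. van Geemen, LNM 1594 (1994), Lemma 5.2 (2)(3), 5.4.
* Cell records: STRUCTURE.md v1.0-SIGNED 9b196a05977dd067 §1 D6 and §2 (S4); `s4push/prove-1/ATTEMPT-15.md`, `ATTEMPT-16.md`.
-/

noncomputable section

open Complex Module Matrix
open Literature.Geometry.Kaehler Literature.Geometry.Kaehler.ComplexTorus
open Literature.Geometry.Kaehler.ComplexTorus.WeilHermitian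

namespace Summit.Ventures.HSemireg

namespace SecantParity

/-! ## §1 Block core: `α = (0 B; C 0)`, `G = (G₁ 0; 0 G₂)`, the first block as a `K`-basis -/

section BlockCore

variable {ι : Type*} [Fintype ι] [DecidableEq ι] {d : ℕ}
  (G₁ G₂ B C : Matrix ι ι ℚ) (α : SqrtNegMat (ι ⊕ ι) d) (hα : α.1 = Matrix.fromBlocks 0 B C 0)

include hα in
/-- **`H(e_i, e_j) = √-d · (G₁)ᵢⱼ` on the standard vectors of the first block**: the real part `E(e_i, α e_j)` vanishes
because `α` maps the first block into the second and `G` is block diagonal (Markman: «`H((0,y_i),(0,y_j)) = d√-d Θ(y_i, y_j)`»).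
[cite: Markman2025SecantWeil, §3.1 Lemma 3.1.3 (proof)] [cite: Lange2023AbelianVarietiesComplex, §7.3.3 Exercise (5)(a)] -/
theorem hermFun_single_inl (i j : ι) :
    hermFun (Matrix.fromBlocks G₁ 0 0 G₂) α ((WeilVec.toVec α).symm (Pi.single (Sum.inl i) 1))
        ((WeilVec.toVec α).symm (Pi.single (Sum.inl j) 1)) = ⟨0, G₁ i j⟩ := by
  apply QuadraticAlgebra.ext
  · rw [hermFun_re, LinearEquiv.apply_symm_apply, LinearEquiv.apply_symm_apply, ratForm, hα,
      Matrix.mulVec_mulVec, Matrix.fromBlocks_multiply, Matrix.mulVec_single_one, single_one_dotProduct]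
    simp
  · rw [hermFun_im, LinearEquiv.apply_symm_apply, LinearEquiv.apply_symm_apply, ratForm,
      Matrix.mulVec_single_one, single_one_dotProduct]
    simp

include hα in
/-- **The first block is `K`-free**: if `det C ≠ 0`, the vectors `e_i`, `i ∈ ι`, of the first block are `K`-linearly
independent in `H₁ = ℚ^{ι ⊔ ι}` (`Σ zᵢ e_i = (Re z, C·Im z)`). [cite: Markman2025SecantWeil, §3.1 Lemma 3.1.3 (proof: «we get the K-basis»)] -/
theorem linearIndependent_single_inl (hC : C.det ≠ 0) :
    LinearIndependent (RatSqrtNeg d) (fun i : ι ↦ (WeilVec.toVec α).symm (Pi.single (Sum.inl i) (1 : ℚ))) := by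
  rw [Fintype.linearIndependent_iff]
  intro z hz
  have h := congrArg (WeilVec.toVec α) hz
  rw [map_sum, map_zero] at h
  simp_rw [WeilVec.smul_def, LinearEquiv.apply_symm_apply, hα, Matrix.mulVec_single_one] at h
  have hre : ∀ i, (z i).re = 0 := fun i ↦ by
    have hi := congrFun h (Sum.inl i)
    simpa [Finset.sum_apply, Pi.single_apply, Matrix.fromBlocks_apply₁₁] using hi
  have him : (fun j ↦ (z j).im) = 0 := by
    refine Matrix.eq_zero_of_mulVec_eq_zero hC ?_
    funext k
    have hk := congrFun h (Sum.inr k)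
    simp only [Finset.sum_apply, Pi.add_apply, Pi.smul_apply, Pi.single_apply, Matrix.col_apply,
      Matrix.fromBlocks_apply₂₁, smul_eq_mul, Pi.zero_apply, reduceCtorEq, if_false, mul_zero, zero_add] at hk
    calc (C *ᵥ fun j ↦ (z j).im) k = ∑ x, C k x * (z x).im := rfl
      _ = ∑ x, (z x).im * C k x := Finset.sum_congr rfl fun x _ ↦ mul_comm _ _
      _ = 0 := hk
  intro i
  exact QuadraticAlgebra.ext (hre i) (by simpa using congrFun him i)

/-- **`dim_K H₁(X × X̂, ℚ) = #ι = rk Λ`** (half of `rk(Λ ⊕ Λ̂)`). [cite: vanGeemen1994HodgeAV, 4.9] -/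
theorem finrank_weilVec_sum [NeZero d] : finrank (RatSqrtNeg d) (WeilVec α) = Fintype.card ι := by
  have h := WeilVec.finrank_mul_two (α := α)
  rw [Fintype.card_sum] at h
  omega

include hα in
/-- **The Hermitian Gram matrix on the first block is `√-d · G₁`** (for any compatibility witness `hc`).
[cite: Markman2025SecantWeil, §3.1 Lemma 3.1.3 (proof)] [cite: vanGeemen1994HodgeAV, Lemma 5.2 (3)] -/
theorem hermGram_single_inl [NeZero d]
    (hc : α.1ᵀ * Matrix.fromBlocks G₁ 0 0 G₂ * α.1 = (d : ℚ) • Matrix.fromBlocks G₁ 0 0 G₂) :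
    hermGram (hermForm (Matrix.fromBlocks G₁ 0 0 G₂) α hc)
        (fun i : ι ↦ (WeilVec.toVec α).symm (Pi.single (Sum.inl i) (1 : ℚ))) =
      (QuadraticAlgebra.omega : RatSqrtNeg d) • G₁.map (Rat.cast : ℚ → RatSqrtNeg d) := by
  ext i j : 1
  rw [WeilHermitian.hermGram_apply, hermForm_apply, hermFun_single_inl G₁ G₂ B C α hα, Matrix.smul_apply, Matrix.map_apply,
    smul_eq_mul, show ((G₁ i j : ℚ) : RatSqrtNeg d) = ⟨G₁ i j, 0⟩ from rfl, QuadraticAlgebra.omega_mul_mk]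
  ext <;> simp

/-- **`det(√-d · M) = (-d)^k · det M`** for a rational `M` and `#ι = 2k` (`(√-d)^{2k} = (-d)^k`; Markman:
«`(d√-d)^{2n} … = (-1)ⁿ d^{3n} …`»). [cite: Markman2025SecantWeil, §3.1 Lemma 3.1.3 (proof)] -/
theorem det_omega_smul_map_re [NeZero d] {k : ℕ} (hk : Fintype.card ι = 2 * k) (M : Matrix ι ι ℚ) :
    (((QuadraticAlgebra.omega : RatSqrtNeg d) • M.map (Rat.cast : ℚ → RatSqrtNeg d)).det).re =
      (-(d : ℚ)) ^ k * M.det := by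
  have hmap : (M.map (Rat.cast : ℚ → RatSqrtNeg d)).det = ((M.det : ℚ) : RatSqrtNeg d) := by
    rw [show M.map (Rat.cast : ℚ → RatSqrtNeg d) = (Rat.castHom (RatSqrtNeg d)).mapMatrix M from rfl,
      ← RingHom.map_det]
    rfl
  have hω : (QuadraticAlgebra.omega : RatSqrtNeg d) ^ (2 * k) = (((-(d : ℚ)) ^ k : ℚ) : RatSqrtNeg d) := by
    rw [pow_mul, sq, QuadraticAlgebra.omega_mul_omega_eq_mk, Rat.cast_pow]
    rfl
  rw [Matrix.det_smul, hk, hω, hmap, ← Rat.cast_mul]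
  rfl

/-- `d = Nm(√-d)`: the class of `d` is trivial in `ℚˣ ⧸ Nm(Kˣ)`. [cite: Lange2023AbelianVarietiesComplex, §7.3.3 Exercise (5)(c)] -/
theorem mk0_natCast_mem_normUnits [NeZero d] (hd : (d : ℚ) ≠ 0) : Units.mk0 (d : ℚ) hd ∈ normUnits d := by
  refine ⟨Units.mk0 (QuadraticAlgebra.omega : RatSqrtNeg d) ?_, Units.ext ?_⟩
  · intro h0
    have h1 := congrArg QuadraticAlgebra.im h0
    rw [QuadraticAlgebra.omega_im, QuadraticAlgebra.im_zero] at h1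
    exact one_ne_zero h1
  · rw [Units.coe_map, Units.val_mk0, Units.val_mk0, norm_eq', QuadraticAlgebra.omega_re, QuadraticAlgebra.omega_im]
    ring

/-- `r² = Nm(r)`: squares of non-zero rationals are norms. [cite: Lange2023AbelianVarietiesComplex, §7.3.3 Exercise (5)(c)] -/
theorem mk0_sq_mem_normUnits [NeZero d] {r : ℚ} (hr : r ≠ 0) : Units.mk0 r hr ^ 2 ∈ normUnits d := by
  refine ⟨Units.mk0 ((r : ℚ) : RatSqrtNeg d) ?_, Units.ext ?_⟩
  · intro h0
    have h1 : ((r : ℚ) : RatSqrtNeg d).re = (0 : RatSqrtNeg d).re := by rw [h0]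
    exact hr h1
  · rw [Units.coe_map, Units.val_mk0, Units.val_pow_eq_pow_val, Units.val_mk0, norm_eq']
    change r ^ 2 + (d : ℚ) * 0 ^ 2 = r ^ 2
    ring

/-- **`[(-d)^k · r²] = [(-1)^k]` in `ℚˣ ⧸ Nm(Kˣ)`** (Markman: «`det(Θ(y_i,y_j))` is the square of a rational number … and
`d^{3n} = Nm((√-d)^{3n})`. Hence `det(H) Nm(Kˣ) = (-1)ⁿ Nm(Kˣ)`»). [cite: Markman2025SecantWeil, §3.1 Lemma 3.1.3 (proof)] -/
theorem mk_mk0_neg_pow_mul_sq [NeZero d] {k : ℕ} {r : ℚ} (hr : r ≠ 0) (hx : (-(d : ℚ)) ^ k * r ^ 2 ≠ 0) :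
    (QuotientGroup.mk (Units.mk0 ((-(d : ℚ)) ^ k * r ^ 2) hx) : ℚˣ ⧸ normUnits d) =
      QuotientGroup.mk ((-1) ^ k) := by
  have hd : (d : ℚ) ≠ 0 := Nat.cast_ne_zero.2 (NeZero.ne d)
  have e : Units.mk0 ((-(d : ℚ)) ^ k * r ^ 2) hx = (-1) ^ k * (Units.mk0 (d : ℚ) hd ^ k * Units.mk0 r hr ^ 2) := by
    ext
    simp only [Units.val_mk0, Units.val_mul, Units.val_pow_eq_pow_val, Units.val_neg, Units.val_one]
    ring
  rw [e]
  exact QuotientGroup.mk_mul_of_mem _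
    (Subgroup.mul_mem _ (Subgroup.pow_mem _ (mk0_natCast_mem_normUnits hd) k) (mk0_sq_mem_normUnits hr))

end BlockCore

/-! ## §2 Markman's triple `(X × X̂, K = ℚ(A), N·(±Ξ_d))`: rational Gram matrix and discriminant -/

section Markman

variable {ι : Type*} [Fintype ι] [DecidableEq ι] {E : Type*} [NormedAddCommGroup E] [NormedSpace ℂ E]
  (Φ : (ι → ℝ) ≃L[ℝ] E) {η : E [⋀^Fin 2]→L[ℝ] ℝ}
  (h₁₁ : ∀ u v : E, η ![I • u, I • v] = η ![u, v]) (hnd : ∀ u : E, (∀ v, η ![u, v] = 0) → u = 0)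
  {G : Matrix ι ι ℤ}

/-- `N·Ξ_d = (N d)·η ⊞ N·η^*` (file XII's `smul_Xi_eq`, restated here so that this file does not import XII).
[cite: Lange2023AbelianVarietiesComplex, §2.4.4 Cor. 2.4.24] -/
private theorem smul_prodForm_smul_dualForm (N d : ℝ) :
    N • prodForm ((d : ℝ) • η) (dualForm Φ h₁₁ hnd) = prodForm ((N * d : ℝ) • η) ((N : ℝ) • dualForm Φ h₁₁ hnd) := by
  ext v
  rw [ContinuousAlternatingMap.smul_apply, show v = ![v 0, v 1] from by funext i; fin_cases i <;> rfl, prodForm_apply,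
    prodForm_apply, ContinuousAlternatingMap.smul_apply, ContinuousAlternatingMap.smul_apply,
    ContinuousAlternatingMap.smul_apply, smul_eq_mul, smul_eq_mul, smul_eq_mul, smul_eq_mul, mul_add, mul_assoc]

/-- `N·(-Ξ_d) = (-(N d))·η ⊞ (-N)·η^*`. [cite: Lange2023AbelianVarietiesComplex, §2.4.4 Cor. 2.4.24] -/
private theorem smul_neg_prodForm_smul_dualForm (N d : ℝ) :
    N • (-prodForm ((d : ℝ) • η) (dualForm Φ h₁₁ hnd)) =
      prodForm ((-(N * d) : ℝ) • η) ((-N : ℝ) • dualForm Φ h₁₁ hnd) := by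
  ext v
  rw [ContinuousAlternatingMap.smul_apply, ContinuousAlternatingMap.neg_apply,
    show v = ![v 0, v 1] from by funext i; fin_cases i <;> rfl, prodForm_apply,
    prodForm_apply, ContinuousAlternatingMap.smul_apply, ContinuousAlternatingMap.smul_apply,
    ContinuousAlternatingMap.smul_apply, smul_eq_mul, smul_eq_mul, smul_eq_mul, smul_eq_mul]
  ring

omit [Fintype ι] [DecidableEq ι] in
/-- Realification commutes with rational scalars. [folklore] -/
private theorem map_ratCast_smul' {m n : Type*} (c : ℚ) (A : Matrix m n ℚ) :
    (c • A).map (Rat.cast : ℚ → ℝ) = (c : ℝ) • A.map (Rat.cast : ℚ → ℝ) :=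
  Matrix.ext fun i j ↦ by simp only [Matrix.map_apply, Matrix.smul_apply, smul_eq_mul, Rat.cast_mul]

omit [Fintype ι] [DecidableEq ι] in
/-- `ℤ → ℚ → ℝ = ℤ → ℝ` on matrices. [folklore] -/
private theorem map_intCast_map_ratCast' {m n : Type*} (A : Matrix m n ℤ) :
    (A.map (Int.cast : ℤ → ℚ)).map (Rat.cast : ℚ → ℝ) = A.map (Int.cast : ℤ → ℝ) :=
  Matrix.ext fun i j ↦ Rat.cast_intCast (A i j)

include hnd in
/-- `((ᵗG)⁻¹)_ℝ = (ᵗG_ℝ)⁻¹` (realification commutes with inversion for an invertible rational matrix; used for the dual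
polarisation's Gram matrix `(ᵗG)⁻¹`). [cite: Lange2023AbelianVarietiesComplex, §2.5.1 Prop. 2.5.1 (proof)] -/
private theorem map_ratCast_transposeGram_inv (hG : G.map (Int.cast : ℤ → ℝ) = latticeGram Φ η) :
    ((G.transpose.map (Int.cast : ℤ → ℚ))⁻¹).map (Rat.cast : ℚ → ℝ) = ((latticeGram Φ η).transpose)⁻¹ := by
  rw [← map_ratCast_transposeGram Φ hG]
  refine (Matrix.inv_eq_left_inv ?_).symm
  have hm : ((G.transpose.map (Int.cast : ℤ → ℚ))⁻¹ * G.transpose.map (Int.cast : ℤ → ℚ)).map (Rat.cast : ℚ → ℝ) =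
      ((G.transpose.map (Int.cast : ℤ → ℚ))⁻¹).map (Rat.cast : ℚ → ℝ) *
        (G.transpose.map (Int.cast : ℤ → ℚ)).map (Rat.cast : ℚ → ℝ) :=
    Matrix.map_mul (f := Rat.castHom ℝ)
  rw [← hm, Matrix.nonsing_inv_mul _ (isUnit_det_transposeGram Φ hnd hG), Matrix.map_one _ Rat.cast_zero Rat.cast_one]

/-- **The rational Gram matrix of `N·Ξ_d` on the lattice basis of `X × X̂` is `(N d·G 0; 0 N·(ᵗG)⁻¹)`** (block diagonal:
`(N d)·η` on `Λ`, `N·η^*` with Gram matrix `N·(ᵗG)⁻¹` on `Λ̂`). [cite: Lange2023AbelianVarietiesComplex, §2.4.4 Cor. 2.4.24 and §2.5.1 Prop. 2.5.1] -/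
theorem map_ratCast_blockGram (hG : G.map (Int.cast : ℤ → ℝ) = latticeGram Φ η) (N d : ℕ) :
    (Matrix.fromBlocks (((N * d : ℕ) : ℚ) • G.map (Int.cast : ℤ → ℚ)) 0 0
        ((N : ℚ) • (G.transpose.map (Int.cast : ℤ → ℚ))⁻¹)).map (Rat.cast : ℚ → ℝ) =
      latticeGram (prodPeriod Φ (dualPeriod Φ)) (((N : ℕ) : ℝ) • prodForm ((d : ℝ) • η) (dualForm Φ h₁₁ hnd)) := by
  rw [smul_prodForm_smul_dualForm, latticeGram_prod, latticeGram_smul, latticeGram_smul, latticeGram_dualForm,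
    Matrix.fromBlocks_map, map_ratCast_smul', map_ratCast_smul', map_intCast_map_ratCast', hG,
    map_ratCast_transposeGram_inv Φ hnd hG, Matrix.map_zero _ Rat.cast_zero]
  push_cast
  ring_nf

/-- **… and of `N·(-Ξ_d)`: `(-(N d)·G 0; 0 -N·(ᵗG)⁻¹)`.** [cite: Lange2023AbelianVarietiesComplex, §2.4.4 Cor. 2.4.24 and §2.5.1 Prop. 2.5.1] -/
theorem map_ratCast_blockGram_neg (hG : G.map (Int.cast : ℤ → ℝ) = latticeGram Φ η) (N d : ℕ) :
    (Matrix.fromBlocks ((-((N * d : ℕ) : ℚ)) • G.map (Int.cast : ℤ → ℚ)) 0 0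
        ((-(N : ℚ)) • (G.transpose.map (Int.cast : ℤ → ℚ))⁻¹)).map (Rat.cast : ℚ → ℝ) =
      latticeGram (prodPeriod Φ (dualPeriod Φ)) (((N : ℕ) : ℝ) • (-prodForm ((d : ℝ) • η) (dualForm Φ h₁₁ hnd))) := by
  rw [smul_neg_prodForm_smul_dualForm, latticeGram_prod, latticeGram_smul, latticeGram_smul, latticeGram_dualForm,
    Matrix.fromBlocks_map, map_ratCast_smul', map_ratCast_smul', map_intCast_map_ratCast', hG,
    map_ratCast_transposeGram_inv Φ hnd hG, Matrix.map_zero _ Rat.cast_zero]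
  push_cast
  ring_nf

include hnd in
/-- The determinant computation behind both orientations: for `h : IsPolarizedWeilType (X × X̂) E' A d n` with rational Gram
matrix `(c·G 0; 0 G₂)` of `E'`, `c ∈ ℚ`, the discriminant is `[(-1)^{dim_ℂ X}]`.
[cite: Markman2025SecantWeil, §3.1 Lemma 3.1.3] [cite: Lange2023AbelianVarietiesComplex, §7.3.3 Exercise (5)(c)] -/
theorem discriminant_eq_of_blockGram {d : ℕ} [NeZero d] (hη : IsNSForm Φ η)
    (hG : G.map (Int.cast : ℤ → ℝ) = latticeGram Φ η) {η' : (E × (E →L⋆[ℂ] ℂ)) [⋀^Fin 2]→L[ℝ] ℝ} {n : ℕ}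
    (h : IsPolarizedWeilType (prodPeriod Φ (dualPeriod Φ)) η'
        (Matrix.fromBlocks 0 (G.transpose.map (Int.cast : ℤ → ℚ))⁻¹ ((-(d : ℚ)) • G.transpose.map (Int.cast : ℤ → ℚ)) 0)
        d n)
    {c : ℚ} {G₂ : Matrix ι ι ℚ}
    (hGq : (Matrix.fromBlocks (c • G.map (Int.cast : ℤ → ℚ)) 0 0 G₂).map (Rat.cast : ℚ → ℝ) =
      latticeGram (prodPeriod Φ (dualPeriod Φ)) η') :
    h.discriminant = QuotientGroup.mk ((-1) ^ finrank ℂ E) := by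
  haveI : FiniteDimensional ℝ E := LinearEquiv.finiteDimensional Φ.toLinearEquiv
  haveI : FiniteDimensional ℂ E := Module.Finite.of_restrictScalars_finite ℝ ℂ E
  have hcard : Fintype.card ι = 2 * finrank ℂ E := card_eq_two_mul_finrank Φ
  -- `det G = Pf(G)²`
  have hnd' : ∀ v : E, v ≠ 0 → ∃ w : E, η ![v, w] ≠ 0 := fun v hv ↦ by
    by_contra h0
    push Not at h0
    exact hv (hnd v h0)
  obtain ⟨g', δ, hδ, -⟩ := hη.exists_isPolarizationType_of_nondegenerate Φ hnd'
  have hdetQ : (G.map (Int.cast : ℤ → ℚ)).det = (∏ i, (δ i : ℚ)) ^ 2 := by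
    apply Rat.cast_injective (α := ℝ)
    have h1 : (((G.map (Int.cast : ℤ → ℚ)).det : ℚ) : ℝ) = ((G.map (Int.cast : ℤ → ℚ)).map (Rat.cast : ℚ → ℝ)).det :=
      RingHom.map_det (Rat.castHom ℝ) _
    rw [h1, map_intCast_map_ratCast', hG, hδ.det_latticeGram]
    push_cast
    ring_nf
  -- `det (c·G) ≠ 0` from the polarisation
  have hdet1 : (c • G.map (Int.cast : ℤ → ℚ)).det ≠ 0 := by
    have hu := isUnit_det_of_map_ratCast hGq h.isRiemannForm.isUnit_det_latticeGram
    rw [Matrix.det_fromBlocks_zero₂₁, IsUnit.mul_iff] at hu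
    exact hu.1.ne_zero
  -- the `K`-basis given by the lattice basis of the factor `X`
  have hC : ((-(d : ℚ)) • G.transpose.map (Int.cast : ℤ → ℚ)).det ≠ 0 := by
    rw [Matrix.det_smul]
    exact mul_ne_zero (pow_ne_zero _ (neg_ne_zero.2 (Nat.cast_ne_zero.2 (NeZero.ne d))))
      (isUnit_det_transposeGram Φ hnd hG).ne_zero
  have hli := linearIndependent_single_inl (G.transpose.map (Int.cast : ℤ → ℚ))⁻¹
    ((-(d : ℚ)) • G.transpose.map (Int.cast : ℤ → ℚ)) h.sqrtNeg rfl hC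
  have hfin : Fintype.card ι = finrank (RatSqrtNeg d) (WeilVec h.sqrtNeg) := (finrank_weilVec_sum h.sqrtNeg).symm
  obtain ⟨b, hb⟩ : ∃ b : Module.Basis ι (RatSqrtNeg d) (WeilVec h.sqrtNeg),
      ⇑b = fun i : ι ↦ (WeilVec.toVec h.sqrtNeg).symm (Pi.single (Sum.inl i) (1 : ℚ)) :=
    ⟨basisOfLinearIndependentOfCardEqFinrank' _ hli hfin, coe_basisOfLinearIndependentOfCardEqFinrank' _ hli hfin⟩
  rw [← h.discr_eq_discriminant hGq b, h.discr_eq_mk hGq b]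
  have hgram : hermGram (h.hermForm hGq) b =
      (QuadraticAlgebra.omega : RatSqrtNeg d) • (c • G.map (Int.cast : ℤ → ℚ)).map (Rat.cast : ℚ → RatSqrtNeg d) := by
    rw [hb]
    exact hermGram_single_inl (c • G.map (Int.cast : ℤ → ℚ)) G₂ (G.transpose.map (Int.cast : ℤ → ℚ))⁻¹
      ((-(d : ℚ)) • G.transpose.map (Int.cast : ℤ → ℚ)) h.sqrtNeg rfl (h.compat hGq)
  have hre : ((hermGram (h.hermForm hGq) b).det).re =
      (-(d : ℚ)) ^ finrank ℂ E * (c ^ finrank ℂ E * ∏ i, (δ i : ℚ)) ^ 2 := by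
    rw [hgram, det_omega_smul_map_re hcard, Matrix.det_smul, hcard, hdetQ]
    ring
  have hr : c ^ finrank ℂ E * ∏ i, (δ i : ℚ) ≠ 0 := by
    intro h0
    apply hdet1
    rw [Matrix.det_smul, hcard, hdetQ, show c ^ (2 * finrank ℂ E) * (∏ i, (δ i : ℚ)) ^ 2 =
      (c ^ finrank ℂ E * ∏ i, (δ i : ℚ)) ^ 2 by ring, h0]
    ring
  have key : ∀ (x : ℚ) (hx : x ≠ 0), x = (-(d : ℚ)) ^ finrank ℂ E * (c ^ finrank ℂ E * ∏ i, (δ i : ℚ)) ^ 2 →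
      (QuotientGroup.mk (Units.mk0 x hx) : ℚˣ ⧸ normUnits d) = QuotientGroup.mk ((-1) ^ finrank ℂ E) := by
    intro x hx hxe
    subst hxe
    exact mk_mk0_neg_pow_mul_sq hr hx
  exact key _ _ hre

/-- **[Mar25 LEMMA 3.1.3] AT THE OBJECT LEVEL — positive orientation.** For `η ∈ NS(X)` non-degenerate with integer Gram
matrix `G`, `N d : ℕ`, and Markman's `A = (0 (ᵗG)⁻¹; -d·ᵗG 0)`: if `(X × X̂, N·Ξ_d, A)` is a polarised complex torus of Weil type
in the tree's sense (file XIId: iff `η` is a Riemann form of `X`), then **its discriminant is the class of `(-1)^{dim_ℂ X}` in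
`ℚˣ ⧸ Nm(Kˣ)`** — the SPLIT class `(n, K, (-1)ⁿ·Nm Kˣ)`: «Then the discriminant of the hermitian form `H` is `(-1)ⁿ`.»
[cite: Markman2025SecantWeil, §3.1 Lemma 3.1.3] [cite: Lange2023AbelianVarietiesComplex, §7.3.3 Exercise (5)(c)]
[cite: vanGeemen1994HodgeAV, Lemma 5.2 (3)] -/
theorem discriminant_smul_Xi {d : ℕ} [NeZero d] (hη : IsNSForm Φ η) (hG : G.map (Int.cast : ℤ → ℝ) = latticeGram Φ η)
    {N n : ℕ}
    (h : IsPolarizedWeilType (prodPeriod Φ (dualPeriod Φ))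
        (((N : ℕ) : ℝ) • prodForm ((d : ℝ) • η) (dualForm Φ hη.type_one_one hnd))
        (Matrix.fromBlocks 0 (G.transpose.map (Int.cast : ℤ → ℚ))⁻¹ ((-(d : ℚ)) • G.transpose.map (Int.cast : ℤ → ℚ)) 0)
        d n) :
    h.discriminant = QuotientGroup.mk ((-1) ^ finrank ℂ E) :=
  discriminant_eq_of_blockGram Φ hnd hη hG h (map_ratCast_blockGram Φ hη.type_one_one hnd hG N d)

/-- **[Mar25 LEMMA 3.1.3] AT THE OBJECT LEVEL — negative orientation** (`N·(-Ξ_d)`, polarised iff `-η` is a Riemann form, file XIId):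
the discriminant is again the class of `(-1)^{dim_ℂ X}` — BOTH orientations of EVERY `K`-secant triple sit on the split
component; no non-split component `(n, K, δ ≠ (-1)ⁿ)` carries a triple of the form `(X × X̂, f, ±Ξ_P)`.
[cite: Markman2025SecantWeil, §3.1 Lemma 3.1.3] [cite: Markman2025SurveySecant, §1.1 and §11.5]
[cite: Lange2023AbelianVarietiesComplex, §7.3.3 Exercise (5)(c)] -/
theorem discriminant_smul_neg_Xi {d : ℕ} [NeZero d] (hη : IsNSForm Φ η) (hG : G.map (Int.cast : ℤ → ℝ) = latticeGram Φ η)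
    {N n : ℕ}
    (h : IsPolarizedWeilType (prodPeriod Φ (dualPeriod Φ))
        (((N : ℕ) : ℝ) • (-prodForm ((d : ℝ) • η) (dualForm Φ hη.type_one_one hnd)))
        (Matrix.fromBlocks 0 (G.transpose.map (Int.cast : ℤ → ℚ))⁻¹ ((-(d : ℚ)) • G.transpose.map (Int.cast : ℤ → ℚ)) 0)
        d n) :
    h.discriminant = QuotientGroup.mk ((-1) ^ finrank ℂ E) :=
  discriminant_eq_of_blockGram Φ hnd hη hG h (map_ratCast_blockGram_neg Φ hη.type_one_one hnd hG N d)

include hnd in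
/-- **… and along `K`-ISOGENIES.** If `(Y, f^*E', α₁)` is a polarised complex torus of Weil type and `f = ρ(A₀) : Y → X × X̂` an isogeny
intertwining `α₁` with Markman's `A` and pulling the block-Gram polarisation `E'` (e.g. `N·(±Ξ_d)`) back to `Y`'s, then `Y`'s discriminant
is `[(-1)^{dim_ℂ X}]` as well: the whole `K`-isogeny class of a secant triple lies on the split component (tree: the discriminant is an
isogeny invariant, [vG94 Lemma 5.2 (3)] «isogenies are isomorphisms on `(H₁)_ℚ` …»). [cite: vanGeemen1994HodgeAV, Lemma 5.2 (3)]
[cite: Markman2025SecantWeil, §3.1 Lemma 3.1.3] -/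
theorem discriminant_eq_of_isIsogeny_of_blockGram {d : ℕ} [NeZero d] (hη : IsNSForm Φ η)
    (hG : G.map (Int.cast : ℤ → ℝ) = latticeGram Φ η) {η' : (E × (E →L⋆[ℂ] ℂ)) [⋀^Fin 2]→L[ℝ] ℝ} {n : ℕ}
    (h : IsPolarizedWeilType (prodPeriod Φ (dualPeriod Φ)) η'
        (Matrix.fromBlocks 0 (G.transpose.map (Int.cast : ℤ → ℚ))⁻¹ ((-(d : ℚ)) • G.transpose.map (Int.cast : ℤ → ℚ)) 0)
        d n)
    {c : ℚ} {G₂ : Matrix ι ι ℚ}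
    (hGq : (Matrix.fromBlocks (c • G.map (Int.cast : ℤ → ℚ)) 0 0 G₂).map (Rat.cast : ℚ → ℝ) =
      latticeGram (prodPeriod Φ (dualPeriod Φ)) η')
    {ι₁ : Type*} [Fintype ι₁] [DecidableEq ι₁] {E₁ : Type*} [NormedAddCommGroup E₁] [NormedSpace ℂ E₁]
    {Φ₁ : (ι₁ → ℝ) ≃L[ℝ] E₁} {A₀ : Matrix (ι ⊕ ι) ι₁ ℤ} (hA₀ : IsIsogeny Φ₁ (prodPeriod Φ (dualPeriod Φ)) A₀)
    {F : E₁ →L[ℂ] E × (E →L⋆[ℂ] ℂ)} (hF : ∀ x, prodPeriod Φ (dualPeriod Φ) ((A₀.map (Int.cast : ℤ → ℝ)) *ᵥ x) = F (Φ₁ x))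
    {α₁ : Matrix ι₁ ι₁ ℚ} (h₁ : IsPolarizedWeilType Φ₁ (pullbackForm F η') α₁ d n)
    (hAα : Matrix.fromBlocks 0 (G.transpose.map (Int.cast : ℤ → ℚ))⁻¹ ((-(d : ℚ)) • G.transpose.map (Int.cast : ℤ → ℚ)) 0 *
        A₀.map (Int.cast : ℤ → ℚ) = A₀.map (Int.cast : ℤ → ℚ) * α₁) :
    h₁.discriminant = QuotientGroup.mk ((-1) ^ finrank ℂ E) := by
  rw [IsPolarizedWeilType.discriminant_eq_of_isIsogeny hA₀ hF h₁ h hAα]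
  exact discriminant_eq_of_blockGram Φ hnd hη hG h hGq

end Markman

end SecantParity

end Summit.Ventures.HSemireg
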